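import Summits.NavierStokesRegularity.NavierStokesRegularity.Theses.TerminalTrace
import Summits.NavierStokesRegularity.NavierStokesRegularity.Theorems.TerminalTraceTypeITraceScarL3StubLocalTypeIOfTypeIBlowup
import Summits.NavierStokesRegularity.NavierStokesRegularity.Theorems.TerminalTraceTypeITraceScarL3StubExtinctApexDOfL3Trace
import Summits.NavierStokesRegularity.NavierStokesRegularity.Theorems.TerminalTraceTypeITraceScarL3StubNoConfinedExtinctApex
import Literature.Analysis.FluidPDE.LocalTypeI
import Literature.Analysis.FluidPDE.VectorCalculus
import HarnessLib

/-!
# Item `TerminalTrace.TypeITraceScarL3` (stmt-NavierStokesRegularity-18385): the Q-cut of skeleton v4 of line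
# `annulus-dichotomy` (sha16 3f7a14107033987a) as a tree theorem — quiet-shell exclusion follows BY NAME from
# Q1 (centre enstrophy at depth) and Q234 (a quiet shell forbids concentration), and so does the item (with LOUD)

Seat ns-typeII-p3 g10 (cell ns-regularity-ideate), `--supports stmt-NavierStokesRegularity-18385` (helper; the
v4 analogue of T-26.5 / `TerminalTraceTypeITraceScarL3OfShellStubs`).  Everything here is CONDITIONAL on its
displayed hypotheses — the statements of the three OPEN registered stubs of skeleton v4, VERBATIM:
* `hQ1` = `stub_centreEnstrophyAtDepth` (CLOSABLE; C-seat nsreg-C26-p1): a backward-singular extinct Type-I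
  apex of class `(M, D₀, C)` carries scaled enstrophy `≥ κ₀ T₁^{-1/2}` in `B(0, √T₁)` on an epoch at every depth;
* `hQ234` = `stub_quietShell_noConcentration` (CLOSABLE; Tao's two Carleman inequalities are tree theorems):
  a quiet shell of ratio `A₀(M, D₀, C, κ₀, c₂)` forbids that concentration;
* `hLOUD` = `stub_no_loudShellExtinctApex` (OPEN, the residual hard core).
Nothing closes the item; no stub is proved here.

* `no_quietShellExtinctApex_of_Qstubs` — v3's QA statement `stub_no_quietShellExtinctApex` VERBATIM from
  `hQ1` and `hQ234` (obtain `κ₀, c₂`, then `A₀`, then modus ponens);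
* `typeITraceScarL3_of_Qstubs` — the item BY NAME from `hQ1`, `hQ234`, `hLOUD`: Stub C by the QA/LOUD split
  (as in `no_spreadExtinctApex_of_shellStubs`, p590321) and the registered composition over the landed Stubs
  1, 2′, B (`stub_localTypeI_of_typeIBlowup` p576636, `stub_extinctApexD_of_L3trace` p583907,
  `stub_no_confinedExtinctApex` p585263), restated so that no module importing the route file is imported.

WHAT THIS IS NOT: not NS regularity, not item 18385, not Q1 / Q234 / LOUD — a by-name reduction.
[folklore; Tao 2019 arXiv:1908.04958 §5; AlbrittonBarker2019 §3]
-/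

noncomputable section

set_option linter.dupNamespace false

namespace Summit.NavierStokesRegularity.NavierStokesRegularity.Theorems.TypeITraceScarL3

open MeasureTheory Set Function Filter Topology Metric
open Literature.Analysis.FluidPDE
open scoped NNReal ENNReal InnerProductSpace RealInnerProductSpace

/-- **Quiet-shell exclusion from Q1 and Q234** (skeleton v4's glue, kernel record): IF every backward-singular
extinct Type-I apex of class `(M, D₀, C)` concentrates enstrophy `≥ κ₀T₁^{-1/2}` at the centre at every depth
(`hQ1`) AND a quiet shell of ratio `A₀(M, D₀, C, κ₀, c₂)` forbids such concentration (`hQ234`), THEN for every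
class there is a ratio `A₀ > 1` such that an extinct Type-I apex with a quiet shell of ratio `A₀` is not
backward singular at the origin (v3's `stub_no_quietShellExtinctApex`, verbatim).
[folklore; Tao 2019 arXiv:1908.04958 §5 ((5.7)–(5.17))] -/
theorem no_quietShellExtinctApex_of_Qstubs
    (hQ1 : ∀ (M D₀ : ℝ≥0) (C : ℝ), ∃ κ₀ : ℝ, 0 < κ₀ ∧ ∃ c₂ : ℝ, 0 < c₂ ∧ c₂ < 1 / 2 ∧
      ∀ (U : ℝ → EuclideanSpace ℝ (Fin 3) → EuclideanSpace ℝ (Fin 3))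
        (P : ℝ → EuclideanSpace ℝ (Fin 3) → ℝ)
        (G : ℝ → EuclideanSpace ℝ (Fin 3) →
          EuclideanSpace ℝ (Fin 3) →L[ℝ] EuclideanSpace ℝ (Fin 3)),
        (∀ a : ℝ, 0 < a →
          IsSuitableWeakSolutionInBall a (0 : ℝ × EuclideanSpace ℝ (Fin 3)) U P) →
        (∀ a : ℝ, 0 < a →
          HasWeakSpatialGradientOn
            (parabolicCylinderOpens a (0 : ℝ × EuclideanSpace ℝ (Fin 3))) U G) →
        (∀ a : ℝ, 0 < a →
          typeIBound (parabolicCylinder a (0 : ℝ × EuclideanSpace ℝ (Fin 3))) U P G ≤ M) →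
        (∀ z₀ : ℝ × EuclideanSpace ℝ (Fin 3), z₀.1 ≤ 0 →
          ∀ r : ℝ, 0 < r → cknD r z₀ P ≤ D₀) →
        (∀ s : ℝ, s < 0 →
          ∀ᵐ y : EuclideanSpace ℝ (Fin 3), ‖U s y‖ ≤ C / Real.sqrt (-s)) →
        (∀ φ : EuclideanSpace ℝ (Fin 3) → EuclideanSpace ℝ (Fin 3),
          ContDiff ℝ (⊤ : ℕ∞) φ →
          HasCompactSupport φ → ∀ ε : ℝ, 0 < ε →
          ∃ s₀ : ℝ, s₀ < 0 ∧ ∀ᵐ s ∂(volume.restrict (Ioo s₀ 0)), |∫ y, ⟪U s y, φ y⟫| ≤ ε) →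
        IsBackwardSingularPoint U (0 : ℝ × EuclideanSpace ℝ (Fin 3)) →
        (∀ T₁ : ℝ, 0 < T₁ → ∃ t₁ ∈ Icc (-T₁) (-T₁ / 2),
          ∀ V : ℝ → EuclideanSpace ℝ (Fin 3) → EuclideanSpace ℝ (Fin 3),
            Function.uncurry V =ᵐ[volume.restrict
                (Ioo (-2 * T₁) (-T₁ / 4) ×ˢ (univ : Set (EuclideanSpace ℝ (Fin 3))))]
              Function.uncurry U →
            ContinuousOn (Function.uncurry V)
              (Ioo (-2 * T₁) (-T₁ / 4) ×ˢ (univ : Set (EuclideanSpace ℝ (Fin 3)))) →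
            (∀ t ∈ Ioo (-2 * T₁) (-T₁ / 4), ContDiff ℝ 1 (V t)) →
            ∀ t ∈ Icc (t₁ - c₂ * T₁) t₁,
              κ₀ * T₁ ^ (-(1 / 2 : ℝ)) ≤
                ∫ x in ball (0 : EuclideanSpace ℝ (Fin 3)) (Real.sqrt T₁), ‖curl (V t) x‖ ^ 2))
    (hQ234 : ∀ (M D₀ : ℝ≥0) (C κ₀ c₂ : ℝ), 0 < κ₀ → 0 < c₂ → c₂ < 1 / 2 → ∃ A₀ : ℝ, 1 < A₀ ∧
      ∀ (U : ℝ → EuclideanSpace ℝ (Fin 3) → EuclideanSpace ℝ (Fin 3))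
        (P : ℝ → EuclideanSpace ℝ (Fin 3) → ℝ)
        (G : ℝ → EuclideanSpace ℝ (Fin 3) →
          EuclideanSpace ℝ (Fin 3) →L[ℝ] EuclideanSpace ℝ (Fin 3)),
        (∀ a : ℝ, 0 < a →
          IsSuitableWeakSolutionInBall a (0 : ℝ × EuclideanSpace ℝ (Fin 3)) U P) →
        (∀ a : ℝ, 0 < a →
          HasWeakSpatialGradientOn
            (parabolicCylinderOpens a (0 : ℝ × EuclideanSpace ℝ (Fin 3))) U G) →
        (∀ a : ℝ, 0 < a →
          typeIBound (parabolicCylinder a (0 : ℝ × EuclideanSpace ℝ (Fin 3))) U P G ≤ M) →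
        (∀ z₀ : ℝ × EuclideanSpace ℝ (Fin 3), z₀.1 ≤ 0 →
          ∀ r : ℝ, 0 < r → cknD r z₀ P ≤ D₀) →
        (∀ s : ℝ, s < 0 →
          ∀ᵐ y : EuclideanSpace ℝ (Fin 3), ‖U s y‖ ≤ C / Real.sqrt (-s)) →
        (∀ φ : EuclideanSpace ℝ (Fin 3) → EuclideanSpace ℝ (Fin 3),
          ContDiff ℝ (⊤ : ℕ∞) φ →
          HasCompactSupport φ → ∀ ε : ℝ, 0 < ε →
          ∃ s₀ : ℝ, s₀ < 0 ∧ ∀ᵐ s ∂(volume.restrict (Ioo s₀ 0)), |∫ y, ⟪U s y, φ y⟫| ≤ ε) →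
        (∃ δ : ℝ, 0 < δ ∧ ∃ R : ℝ, 0 < R ∧ ∃ K : ℝ,
          ∀ᵐ z ∂(volume.restrict
            (Ioo (-δ) 0 ×ˢ {y : EuclideanSpace ℝ (Fin 3) | R < ‖y‖ ∧ ‖y‖ < A₀ * R})),
              ‖U z.1 z.2‖ ≤ K) →
        ¬ (∀ T₁ : ℝ, 0 < T₁ → ∃ t₁ ∈ Icc (-T₁) (-T₁ / 2),
          ∀ V : ℝ → EuclideanSpace ℝ (Fin 3) → EuclideanSpace ℝ (Fin 3),
            Function.uncurry V =ᵐ[volume.restrict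
                (Ioo (-2 * T₁) (-T₁ / 4) ×ˢ (univ : Set (EuclideanSpace ℝ (Fin 3))))]
              Function.uncurry U →
            ContinuousOn (Function.uncurry V)
              (Ioo (-2 * T₁) (-T₁ / 4) ×ˢ (univ : Set (EuclideanSpace ℝ (Fin 3)))) →
            (∀ t ∈ Ioo (-2 * T₁) (-T₁ / 4), ContDiff ℝ 1 (V t)) →
            ∀ t ∈ Icc (t₁ - c₂ * T₁) t₁,
              κ₀ * T₁ ^ (-(1 / 2 : ℝ)) ≤
                ∫ x in ball (0 : EuclideanSpace ℝ (Fin 3)) (Real.sqrt T₁), ‖curl (V t) x‖ ^ 2)) :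
    ∀ (M D₀ : ℝ≥0) (C : ℝ), ∃ A₀ : ℝ, 1 < A₀ ∧
    ∀ (U : ℝ → EuclideanSpace ℝ (Fin 3) → EuclideanSpace ℝ (Fin 3))
      (P : ℝ → EuclideanSpace ℝ (Fin 3) → ℝ)
      (G : ℝ → EuclideanSpace ℝ (Fin 3) →
        EuclideanSpace ℝ (Fin 3) →L[ℝ] EuclideanSpace ℝ (Fin 3)),
      (∀ a : ℝ, 0 < a →
        IsSuitableWeakSolutionInBall a (0 : ℝ × EuclideanSpace ℝ (Fin 3)) U P) →
      (∀ a : ℝ, 0 < a →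
        HasWeakSpatialGradientOn
          (parabolicCylinderOpens a (0 : ℝ × EuclideanSpace ℝ (Fin 3))) U G) →
      (∀ a : ℝ, 0 < a →
        typeIBound (parabolicCylinder a (0 : ℝ × EuclideanSpace ℝ (Fin 3))) U P G ≤ M) →
      (∀ z₀ : ℝ × EuclideanSpace ℝ (Fin 3), z₀.1 ≤ 0 →
        ∀ r : ℝ, 0 < r → cknD r z₀ P ≤ D₀) →
      (∀ s : ℝ, s < 0 →
        ∀ᵐ y : EuclideanSpace ℝ (Fin 3), ‖U s y‖ ≤ C / Real.sqrt (-s)) →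
      (∀ φ : EuclideanSpace ℝ (Fin 3) → EuclideanSpace ℝ (Fin 3),
        ContDiff ℝ (⊤ : ℕ∞) φ →
        HasCompactSupport φ → ∀ ε : ℝ, 0 < ε →
        ∃ s₀ : ℝ, s₀ < 0 ∧ ∀ᵐ s ∂(volume.restrict (Ioo s₀ 0)), |∫ y, ⟪U s y, φ y⟫| ≤ ε) →
      (∃ δ : ℝ, 0 < δ ∧ ∃ R : ℝ, 0 < R ∧ ∃ K : ℝ,
        ∀ᵐ z ∂(volume.restrict
          (Ioo (-δ) 0 ×ˢ {y : EuclideanSpace ℝ (Fin 3) | R < ‖y‖ ∧ ‖y‖ < A₀ * R})),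
            ‖U z.1 z.2‖ ≤ K) →
      ¬ IsBackwardSingularPoint U (0 : ℝ × EuclideanSpace ℝ (Fin 3)) := by
  intro M D₀ C
  obtain ⟨κ₀, hκ₀, c₂, hc₂, hc₂', hQ1'⟩ := hQ1 M D₀ C
  obtain ⟨A₀, hA₀, hQ234'⟩ := hQ234 M D₀ C κ₀ c₂ hκ₀ hc₂ hc₂'
  refine ⟨A₀, hA₀, fun U P G hsw hG hI hD hrate htop hQA hsing => ?_⟩
  exact hQ234' U P G hsw hG hI hD hrate htop hQA (hQ1' U P G hsw hG hI hD hrate htop hsing)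

/-- **`TypeITraceScarL3` from Q1, Q234 and LOUD** (skeleton v4 BY NAME, kernel record): the statements of the
three open registered stubs `stub_centreEnstrophyAtDepth`, `stub_quietShell_noConcentration`,
`stub_no_loudShellExtinctApex` (verbatim) together imply the item.  Proof = the registered composition: an
`L³` ball at a backward-singular vertex of a Type-I-in-time first singularity produces a backward-singular
extinct apex (Stub 2′ over Stub 1); a CONFINED one is excluded by Stub B; otherwise fix the class ratio `A₀`
from `no_quietShellExtinctApex_of_Qstubs` and split on the quiet-shell clause: quiet ⇒ that theorem, loud ⇒
`hLOUD`.  [folklore; Tao 2019 arXiv:1908.04958 §5; Seregin2014 §6.6; AlbrittonBarker2019 §3] -/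
theorem typeITraceScarL3_of_Qstubs
    (hQ1 : ∀ (M D₀ : ℝ≥0) (C : ℝ), ∃ κ₀ : ℝ, 0 < κ₀ ∧ ∃ c₂ : ℝ, 0 < c₂ ∧ c₂ < 1 / 2 ∧
      ∀ (U : ℝ → EuclideanSpace ℝ (Fin 3) → EuclideanSpace ℝ (Fin 3))
        (P : ℝ → EuclideanSpace ℝ (Fin 3) → ℝ)
        (G : ℝ → EuclideanSpace ℝ (Fin 3) →
          EuclideanSpace ℝ (Fin 3) →L[ℝ] EuclideanSpace ℝ (Fin 3)),
        (∀ a : ℝ, 0 < a →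
          IsSuitableWeakSolutionInBall a (0 : ℝ × EuclideanSpace ℝ (Fin 3)) U P) →
        (∀ a : ℝ, 0 < a →
          HasWeakSpatialGradientOn
            (parabolicCylinderOpens a (0 : ℝ × EuclideanSpace ℝ (Fin 3))) U G) →
        (∀ a : ℝ, 0 < a →
          typeIBound (parabolicCylinder a (0 : ℝ × EuclideanSpace ℝ (Fin 3))) U P G ≤ M) →
        (∀ z₀ : ℝ × EuclideanSpace ℝ (Fin 3), z₀.1 ≤ 0 →
          ∀ r : ℝ, 0 < r → cknD r z₀ P ≤ D₀) →
        (∀ s : ℝ, s < 0 →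
          ∀ᵐ y : EuclideanSpace ℝ (Fin 3), ‖U s y‖ ≤ C / Real.sqrt (-s)) →
        (∀ φ : EuclideanSpace ℝ (Fin 3) → EuclideanSpace ℝ (Fin 3),
          ContDiff ℝ (⊤ : ℕ∞) φ →
          HasCompactSupport φ → ∀ ε : ℝ, 0 < ε →
          ∃ s₀ : ℝ, s₀ < 0 ∧ ∀ᵐ s ∂(volume.restrict (Ioo s₀ 0)), |∫ y, ⟪U s y, φ y⟫| ≤ ε) →
        IsBackwardSingularPoint U (0 : ℝ × EuclideanSpace ℝ (Fin 3)) →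
        (∀ T₁ : ℝ, 0 < T₁ → ∃ t₁ ∈ Icc (-T₁) (-T₁ / 2),
          ∀ V : ℝ → EuclideanSpace ℝ (Fin 3) → EuclideanSpace ℝ (Fin 3),
            Function.uncurry V =ᵐ[volume.restrict
                (Ioo (-2 * T₁) (-T₁ / 4) ×ˢ (univ : Set (EuclideanSpace ℝ (Fin 3))))]
              Function.uncurry U →
            ContinuousOn (Function.uncurry V)
              (Ioo (-2 * T₁) (-T₁ / 4) ×ˢ (univ : Set (EuclideanSpace ℝ (Fin 3)))) →
            (∀ t ∈ Ioo (-2 * T₁) (-T₁ / 4), ContDiff ℝ 1 (V t)) →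
            ∀ t ∈ Icc (t₁ - c₂ * T₁) t₁,
              κ₀ * T₁ ^ (-(1 / 2 : ℝ)) ≤
                ∫ x in ball (0 : EuclideanSpace ℝ (Fin 3)) (Real.sqrt T₁), ‖curl (V t) x‖ ^ 2))
    (hQ234 : ∀ (M D₀ : ℝ≥0) (C κ₀ c₂ : ℝ), 0 < κ₀ → 0 < c₂ → c₂ < 1 / 2 → ∃ A₀ : ℝ, 1 < A₀ ∧
      ∀ (U : ℝ → EuclideanSpace ℝ (Fin 3) → EuclideanSpace ℝ (Fin 3))
        (P : ℝ → EuclideanSpace ℝ (Fin 3) → ℝ)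
        (G : ℝ → EuclideanSpace ℝ (Fin 3) →
          EuclideanSpace ℝ (Fin 3) →L[ℝ] EuclideanSpace ℝ (Fin 3)),
        (∀ a : ℝ, 0 < a →
          IsSuitableWeakSolutionInBall a (0 : ℝ × EuclideanSpace ℝ (Fin 3)) U P) →
        (∀ a : ℝ, 0 < a →
          HasWeakSpatialGradientOn
            (parabolicCylinderOpens a (0 : ℝ × EuclideanSpace ℝ (Fin 3))) U G) →
        (∀ a : ℝ, 0 < a →
          typeIBound (parabolicCylinder a (0 : ℝ × EuclideanSpace ℝ (Fin 3))) U P G ≤ M) →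
        (∀ z₀ : ℝ × EuclideanSpace ℝ (Fin 3), z₀.1 ≤ 0 →
          ∀ r : ℝ, 0 < r → cknD r z₀ P ≤ D₀) →
        (∀ s : ℝ, s < 0 →
          ∀ᵐ y : EuclideanSpace ℝ (Fin 3), ‖U s y‖ ≤ C / Real.sqrt (-s)) →
        (∀ φ : EuclideanSpace ℝ (Fin 3) → EuclideanSpace ℝ (Fin 3),
          ContDiff ℝ (⊤ : ℕ∞) φ →
          HasCompactSupport φ → ∀ ε : ℝ, 0 < ε →
          ∃ s₀ : ℝ, s₀ < 0 ∧ ∀ᵐ s ∂(volume.restrict (Ioo s₀ 0)), |∫ y, ⟪U s y, φ y⟫| ≤ ε) →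
        (∃ δ : ℝ, 0 < δ ∧ ∃ R : ℝ, 0 < R ∧ ∃ K : ℝ,
          ∀ᵐ z ∂(volume.restrict
            (Ioo (-δ) 0 ×ˢ {y : EuclideanSpace ℝ (Fin 3) | R < ‖y‖ ∧ ‖y‖ < A₀ * R})),
              ‖U z.1 z.2‖ ≤ K) →
        ¬ (∀ T₁ : ℝ, 0 < T₁ → ∃ t₁ ∈ Icc (-T₁) (-T₁ / 2),
          ∀ V : ℝ → EuclideanSpace ℝ (Fin 3) → EuclideanSpace ℝ (Fin 3),
            Function.uncurry V =ᵐ[volume.restrict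
                (Ioo (-2 * T₁) (-T₁ / 4) ×ˢ (univ : Set (EuclideanSpace ℝ (Fin 3))))]
              Function.uncurry U →
            ContinuousOn (Function.uncurry V)
              (Ioo (-2 * T₁) (-T₁ / 4) ×ˢ (univ : Set (EuclideanSpace ℝ (Fin 3)))) →
            (∀ t ∈ Ioo (-2 * T₁) (-T₁ / 4), ContDiff ℝ 1 (V t)) →
            ∀ t ∈ Icc (t₁ - c₂ * T₁) t₁,
              κ₀ * T₁ ^ (-(1 / 2 : ℝ)) ≤
                ∫ x in ball (0 : EuclideanSpace ℝ (Fin 3)) (Real.sqrt T₁), ‖curl (V t) x‖ ^ 2))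
    (hLOUD : ∀ (M D₀ : ℝ≥0) (C A₀ : ℝ), 1 < A₀ →
      (∀ (U : ℝ → EuclideanSpace ℝ (Fin 3) → EuclideanSpace ℝ (Fin 3))
        (P : ℝ → EuclideanSpace ℝ (Fin 3) → ℝ)
        (G : ℝ → EuclideanSpace ℝ (Fin 3) →
          EuclideanSpace ℝ (Fin 3) →L[ℝ] EuclideanSpace ℝ (Fin 3)),
        (∀ a : ℝ, 0 < a →
          IsSuitableWeakSolutionInBall a (0 : ℝ × EuclideanSpace ℝ (Fin 3)) U P) →
        (∀ a : ℝ, 0 < a →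
          HasWeakSpatialGradientOn
            (parabolicCylinderOpens a (0 : ℝ × EuclideanSpace ℝ (Fin 3))) U G) →
        (∀ a : ℝ, 0 < a →
          typeIBound (parabolicCylinder a (0 : ℝ × EuclideanSpace ℝ (Fin 3))) U P G ≤ M) →
        (∀ z₀ : ℝ × EuclideanSpace ℝ (Fin 3), z₀.1 ≤ 0 →
          ∀ r : ℝ, 0 < r → cknD r z₀ P ≤ D₀) →
        (∀ s : ℝ, s < 0 →
          ∀ᵐ y : EuclideanSpace ℝ (Fin 3), ‖U s y‖ ≤ C / Real.sqrt (-s)) →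
        (∀ φ : EuclideanSpace ℝ (Fin 3) → EuclideanSpace ℝ (Fin 3),
          ContDiff ℝ (⊤ : ℕ∞) φ →
          HasCompactSupport φ → ∀ ε : ℝ, 0 < ε →
          ∃ s₀ : ℝ, s₀ < 0 ∧ ∀ᵐ s ∂(volume.restrict (Ioo s₀ 0)), |∫ y, ⟪U s y, φ y⟫| ≤ ε) →
        (∃ δ : ℝ, 0 < δ ∧ ∃ R : ℝ, 0 < R ∧ ∃ K : ℝ,
          ∀ᵐ z ∂(volume.restrict
            (Ioo (-δ) 0 ×ˢ {y : EuclideanSpace ℝ (Fin 3) | R < ‖y‖ ∧ ‖y‖ < A₀ * R})),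
              ‖U z.1 z.2‖ ≤ K) →
        ¬ IsBackwardSingularPoint U (0 : ℝ × EuclideanSpace ℝ (Fin 3))) →
      ∀ (U : ℝ → EuclideanSpace ℝ (Fin 3) → EuclideanSpace ℝ (Fin 3))
        (P : ℝ → EuclideanSpace ℝ (Fin 3) → ℝ)
        (G : ℝ → EuclideanSpace ℝ (Fin 3) →
          EuclideanSpace ℝ (Fin 3) →L[ℝ] EuclideanSpace ℝ (Fin 3)),
        (∀ a : ℝ, 0 < a →
          IsSuitableWeakSolutionInBall a (0 : ℝ × EuclideanSpace ℝ (Fin 3)) U P) →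
        (∀ a : ℝ, 0 < a →
          HasWeakSpatialGradientOn
            (parabolicCylinderOpens a (0 : ℝ × EuclideanSpace ℝ (Fin 3))) U G) →
        (∀ a : ℝ, 0 < a →
          typeIBound (parabolicCylinder a (0 : ℝ × EuclideanSpace ℝ (Fin 3))) U P G ≤ M) →
        (∀ z₀ : ℝ × EuclideanSpace ℝ (Fin 3), z₀.1 ≤ 0 →
          ∀ r : ℝ, 0 < r → cknD r z₀ P ≤ D₀) →
        (∀ s : ℝ, s < 0 →
          ∀ᵐ y : EuclideanSpace ℝ (Fin 3), ‖U s y‖ ≤ C / Real.sqrt (-s)) →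
        (∀ φ : EuclideanSpace ℝ (Fin 3) → EuclideanSpace ℝ (Fin 3),
          ContDiff ℝ (⊤ : ℕ∞) φ →
          HasCompactSupport φ → ∀ ε : ℝ, 0 < ε →
          ∃ s₀ : ℝ, s₀ < 0 ∧ ∀ᵐ s ∂(volume.restrict (Ioo s₀ 0)), |∫ y, ⟪U s y, φ y⟫| ≤ ε) →
        (¬ ∃ δ : ℝ, 0 < δ ∧ ∃ R : ℝ, 0 < R ∧ ∃ K : ℝ,
          ∀ᵐ z ∂(volume.restrict
            (Ioo (-δ) 0 ×ˢ {y : EuclideanSpace ℝ (Fin 3) | R < ‖y‖ ∧ ‖y‖ < A₀ * R})),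
              ‖U z.1 z.2‖ ≤ K) →
        ¬ IsBackwardSingularPoint U (0 : ℝ × EuclideanSpace ℝ (Fin 3))) :
    Summit.NavierStokesRegularity.NavierStokesRegularity.Theses.TerminalTrace.TypeITraceScarL3 := by
  intro ν T hν hT u p hcl hLH _hdec hTI x₀ hsing ρ hρ hmem
  obtain ⟨U, P, G, M, D₀, C, hsw, hG, hI, hD, hrate, htop, hsingU⟩ :=
    stub_extinctApexD_of_L3trace ν T hν hT u p hcl hLH hTI x₀
      (TerminalTraceTypeITraceScarL3StubLocalTypeIOfTypeIBlowup.stub_localTypeI_of_typeIBlowup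
        ν T hν hT u p hcl hLH hTI x₀)
      hsing ⟨ρ, hρ, hmem⟩
  by_cases hfar : ∃ δ : ℝ, 0 < δ ∧ ∃ R K : ℝ,
      ∀ᵐ z ∂(volume.restrict
        (Ioo (-δ) 0 ×ˢ (closedBall (0 : EuclideanSpace ℝ (Fin 3)) R)ᶜ)), ‖U z.1 z.2‖ ≤ K
  · exact stub_no_confinedExtinctApex U P G M D₀ C hsw hG hI hD hrate htop hfar hsingU
  · obtain ⟨A₀, hA₀, hQA⟩ := no_quietShellExtinctApex_of_Qstubs hQ1 hQ234 M D₀ C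
    by_cases hquiet : ∃ δ : ℝ, 0 < δ ∧ ∃ R : ℝ, 0 < R ∧ ∃ K : ℝ,
        ∀ᵐ z ∂(volume.restrict
          (Ioo (-δ) 0 ×ˢ {y : EuclideanSpace ℝ (Fin 3) | R < ‖y‖ ∧ ‖y‖ < A₀ * R})),
            ‖U z.1 z.2‖ ≤ K
    · exact hQA U P G hsw hG hI hD hrate htop hquiet hsingU
    · exact hLOUD M D₀ C A₀ hA₀ hQA U P G hsw hG hI hD hrate htop hquiet hsingU

end Summit.NavierStokesRegularity.NavierStokesRegularity.Theorems.TypeITraceScarL3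

end
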